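import Summits.BirchSwinnertonDyer.BirchSwinnertonDyer.Theorems.CongruentShaFreeCutKatoZetaRoad
import Summits.BirchSwinnertonDyer.BirchSwinnertonDyer.Theorems.CongruentShaFreeCutKatoDescentDatumOfH2
import Summits.BirchSwinnertonDyer.BirchSwinnertonDyer.Theorems.CongruentShaFreeCutOfHeegnerNonTorsion
import Summits.BirchSwinnertonDyer.Rank1Residual.Partition.MainConjecturesAnticyclotomicGood
import Literature.NumberTheory.EllipticCurves.AnticyclotomicPConverseLinks
import HarnessLib

set_option linter.dupNamespace false
set_option autoImplicit false

/-! # Route `CongruentShaFreeCut` (rung S2) — crux B `AnalyticRankOneOfRankOneFiniteShaTwo`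
# (stmt-BirchSwinnertonDyer-19080) on the KATO–ZETA / PERRIN-RIOU road over the v2-PINNED datum
# (`IsKatoDescentDatumOfH2`: `𝐇²` as bsd-cn100-ty's package `Kato2004.IwasawaH2Data`; plan g13 RULING
# 2026-08-26T18:51:14Z «the kato-zeta ROAD REGISTERS OVER v2»): `PRFormulaAtTwoH2` and the census twin of
# `Theorems/CongruentShaFreeCutKatoZetaRoadPinned.lean` (p463464, v1 pin)

Cell `bsd-cn100`, prover seat `bsd-cn100-s2-c3` (g7). The v2 twin of p463464: token for token the same
research statement and census, with the v1 pin `KatoDescentDatumPin`/`katoClass` replaced by the v2 pin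
`KatoDescentDatumPinH2`/`KatoDescentDatumPinH2.katoClass` (`Theorems/CongruentShaFreeCutKatoDescentDatumOfH2`),
so that the readings (R)/(K)/(3.1′) are Kato's own statements on `𝐇²` (no fine-Selmer comparison).
Supports, does not close, stmt-BirchSwinnertonDyer-19080. ONE `@[conjecture] def` (the research statement, nothing
asserted) + one plumbing `def` + THEOREMS. HONEST FRAMING: nothing here proves crux B, the leaf
`rankOne_twoConverse_congruentNumber`, the congruent number problem or any case of BSD; every
hypothesis of the census is displayed. PARTITION: none — RANK axis.

## What changes with respect to `Theorems/CongruentShaFreeCutKatoZetaRoad.lean` (g6, p448572)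

There the datum `D : KatoDescentDatum 2` of `(E_n, 2)` was qualified by a FREE interface predicate `IsOf`
and the research reading (PR₂) was Burungale–Skinner's Thm. 10.8 «in consumed form» (… ⟹ analytic rank
`1`) — a localisation of crux B, not a statement below it. Here:
* the datum is PINNED (`KatoDescentDatumPinH2 (E_n) 2 D`: `D.H = 𝐇¹_Γ(T₂E_n)`, `D.A = H¹(ℤ[1/2], T₂E_n)`,
  `D.ι = proj₀`, `D.H2 = 𝐇²_Γ(T₂E_n)` with (14.14.1)), so the print readings are statements about Kato's
  objects, dischargeable by name from print;
* the research statement is Perrin-Riou's FORMULA itself, `PRFormulaAtTwoH2`: for square-free `n`, a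
  Heegner field `K` of `E_n` with `2` split and `L(E_n^{(d_K)}, 1) ≠ 0`, an embedding `ι : K → ℚ₂`, a
  Heegner point `P ∈ E_n(K)`, and a pinned datum `D` satisfying Kato's main conjecture in `Λ ⊗ ℚ`:
  `L(E_n, 1) = 0 ⟹ ∃ c ∈ ℚ₂ˣ, log(loc₂(ι[z])) = c · log_ω(P)²` in the Kummer currency
  `HasLocPKummerLog` — the shape of [ABS] Thm. 10.8 (a) «`log(loc_p(z_E)) = c_P ((p+1−a_p)/p) log(P)²`»
  (printed for GOOD supersingular `p`: Burungale–Kobayashi–Ota 2024, Kobayashi 2013; the Euler factor is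
  absorbed into `c` at the additive prime; `P` = the Heegner point, whose non-torsion is `ord L = 1` by
  Gross–Zagier–Kolyvagin = 10.8 (b), a refereed input of the line of record). OPEN at `(E_n, 2)`:
  Alpöge–Bhargava–Shnidman §2 (after Thm. 2.10) name exactly this generalisation as unavailable.
  It is NOT implied by crux B (it is an identity, also in analytic rank `≥ 3`), and with the print
  readings it implies crux B (§3): a statement with teeth strictly on the research side of B.

## The readings (displayed hypotheses of §3; each a printed theorem read for `(E_n, 2)`)

* (R+K) `hRK` — ∃-form: a pinned datum satisfying Kato's Main Conjecture 12.10 in `Λ ⊗ ℚ₂` EXISTS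
  [Kato Thm. 12.4, §14.14 (14.14.1)–(14.14.2) (`Kato2004.nonempty_iwasawaH1Data` ∧ `nonempty_iwasawaH2Data`);
  Burungale–Tian, Ann. of Math. 203 (2026) Thm. 2.6 = [ABS] Thm. 10.6 — REFEREED, every `p`, every CM
  newform]. The zeta element is pinned by (K) up to `f·Λˣ·p^ℤ`, `f(0) ≠ 0` (docstring of
  `IsKatoDescentDatumOfH2`).
* (3.1′) `h31` — `rank E_n(ℚ) = 1 ∧ #Ш(E_n)[2^∞] < ∞ ⟹ D.H2/T·D.H2` finite [[ABS] §10.1.3: «Sel_st(E) is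
  finite. The same is then true of X_st(E)/(γ−1)X_st(E)»; Kato (14.9.3)].
* (3.1″) `h31b` — under the same hypotheses, a class `ι[z] ∈ H¹(ℤ[1/2], T)` that is not `ℤ₂`-torsion has
  NON-ZERO Kummer logarithm: `HasLocPKummerLog (E_n) 2 pin.katoClass t ⟹ t ≠ 0` [[ABS] §10.1.3: «Since
  Sel_st(E) is finite, it further follows that `0 ≠ loc_p(z_E) ∈ H¹(ℚ_p, V)`»; `log` is injective on
  `E(ℚ_p) ⊗ ℚ_p`, AEC IV.6.4]. (In rank one `H¹(ℤ[1/2], V) = ℚ₂·κ(P_gen)`.)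
* (PR₂) `hPR : PRFormulaAtTwoH2` — THE research statement.
* Kato's finiteness theorem `kato_finite_of_L_one_ne_zero` (`L(E_n,1) = 0` from rank one) and, for crux B,
  the six refereed facts of the line of record (`analyticRankOne_of_facts_of_heegnerNonTorsion`, p419056).

References: [AlpogeBhargavaShnidman2022] App. A (Burungale–Skinner) Thm. 10.1, §10.1.1–10.1.3, Thm. 10.6,
Thm. 10.8, Rem. 10.5 (i); §2 after Thm. 2.10. [BurungaleTian2026] Thm. 2.6. [Kato2004Asterisque] Thm. 12.4,
Conj. 12.10, (14.9.3), §14.14, Cor. 14.3. [BurungaleKobayashiOta2023] Thm. 1.1. [Kobayashi2013]. [BlochKato1990]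
Ex. 3.11. [GrossZagier1986] Thm. I.6.3.
-/

noncomputable section

open scoped Classical

open WeierstrassCurve NumberField IsDedekindDomain Field Literature.NumberTheory.EllipticCurves
  Literature.NumberTheory.EllipticCurves.Rank1Residual Literature.NumberTheory.EllipticCurves.Kato2004
  Literature.NumberTheory.EllipticCurves.Kato2004.EulerSystemValues Literature.NumberTheory.EllipticCurves.Castella2018
  Literature.NumberTheory.GaloisRepresentations
  Summit.BirchSwinnertonDyer.Rank1Residual.Additive
  Summit.BirchSwinnertonDyer.BirchSwinnertonDyer.Theses.CongruentShaFreeCut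
  Summit.BirchSwinnertonDyer.BirchSwinnertonDyer.Theorems.CongruentShaFreeCutKatoDescentDatumOfH2
open Summit.BirchSwinnertonDyer.BirchSwinnertonDyer.Theorems.CongruentShaFreeCutOfHeegnerNonTorsion
  (HeegnerNonTorsionAtTwo analyticRankOne_of_facts_of_heegnerNonTorsion)

namespace Summit.BirchSwinnertonDyer.BirchSwinnertonDyer.Theorems.CongruentShaFreeCutKatoZetaRoadPinnedH2

/-! ## §1 The research statement over the v2 pin -/

/-- **`PRFormulaAtTwoH2` — Perrin-Riou's formula for Kato's zeta element of `E_n` at the ADDITIVE prime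
`2`, in the shape of Burungale–Skinner's Thm. 10.8 (a)** (OPEN; `@[conjecture]`, nothing asserted). For
every square-free `n`, every imaginary quadratic `K` with the Heegner hypothesis for `N = N(E_n)` and for
`2` and with `L(E_n^{(d_K)}, 1) ≠ 0`, every embedding `ι : K → ℚ₂`, every Heegner point `P ∈ E_n(K)` of
level `N`: if `L(E_n, 1) = 0` then for every PINNED Kato descent datum `D` of `(E_n, 2)`
(`KatoDescentDatumPinH2`) satisfying Kato's Main Conjecture 12.10 in `Λ ⊗ ℚ₂` there is `c ∈ ℚ₂`, `c ≠ 0`,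
with `log(loc₂(m·ι[z])) = m · c · log_ω(P)²` for some `m ≠ 0` in the Kummer currency — i.e.
`HasLocPKummerLog (E_n) 2 pin.katoClass (c · log_ω(P)²)`. Printed ([ABS] Thm. 10.8: «If `L(E,1)=0`, there
exist `P ∈ E(ℚ)` and `c_P ∈ ℚˣ` with (a) `log(loc_p(z_E)) = c_P((p+1−a_p(E))/p)·log(P)²`», proved in
Burungale–Kobayashi–Ota 2024 / Kobayashi 2013) ONLY for primes of GOOD supersingular reduction; `E_n` is
additive at `2`; Alpöge–Bhargava–Shnidman §2 (after Thm. 2.10) record that the needed generalisation is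
not available. The Euler factor is absorbed into `c`; `P` is taken to be the Heegner point (so that 10.8
(b) is Gross–Zagier–Kolyvagin, a refereed input); the condition `L(E_n^{(d_K)},1) ≠ 0` makes `P`'s
non-torsion equivalent to `ord_{s=1} L(E_n,s) = 1`. The main conjecture hypothesis pins `D.z` to
`f·Λˣ·2^ℤ·𝐳_{E_n}`, `f(0) ≠ 0` (docstring of `IsKatoDescentDatumOfH2`), a factor which `c` absorbs. NOT implied by crux B
(it is an identity, meaningful also when `ord L ≥ 3`). [cite: AlpogeBhargavaShnidman2022, App. A Thm. 10.8 (a) (p. 33) and §2 after Thm. 2.10]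
[cite: BurungaleKobayashiOta2023, Thm. 1.1 (shape at good supersingular p)] [cite: PerrinRiou1993AIF, §3.3] -/
@[conjecture] def PRFormulaAtTwoH2 : Prop :=
  ∀ ⦃n : ℕ⦄, Squarefree n →
    ∀ [(congruentNumberCurve n).IsElliptic] [(congruentNumberCurve n).IsGloballyMinimal]
      [ContinuousSMul ℤ_[2] ((congruentNumberCurve n).tateModule 2)]
      (K : Type) [Field K] [NumberField K] (N : ℕ) [NeZero N],
      (congruentNumberCurve n).conductorNorm ℤ = N → IsImaginaryQuadratic K →
        SatisfiesHeegnerHypothesis N K → SatisfiesHeegnerHypothesis 2 K →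
          ((congruentNumberCurve n).quadraticTwist (NumberField.discr K : ℚ)).entireLFunction 1 ≠ 0 →
      ∀ (ι : K →+* ℚ_[2]) (P : ((congruentNumberCurve n).baseChange K).toAffine.Point),
        IsHeegnerPoint N (congruentNumberCurve n) K P →
          (congruentNumberCurve n).entireLFunction 1 = 0 →
      ∀ (D : KatoDescentDatum 2) (pin : KatoDescentDatumPinH2 (congruentNumberCurve n) 2 D),
        (∃ a b : ℕ,
          Ideal.span {((2 : ℕ) : IwasawaAlgebra 2) ^ a} * Module.charIdeal (IwasawaAlgebra 2) D.H2 =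
            Ideal.span {((2 : ℕ) : IwasawaAlgebra 2) ^ b} *
              Module.charIdeal (IwasawaAlgebra 2) (D.H ⧸ (IwasawaAlgebra 2) ∙ D.z)) →
        ∃ c : ℚ_[2], c ≠ 0 ∧
          HasLocPKummerLog (congruentNumberCurve n) 2 pin.katoClass
            (c * padicLogOmega (congruentNumberCurve n) 2 ι P ^ 2)

/-! ## §2 The census on the pinned road: (R+K), (3.1′), (3.1″), PRFormula₂ ⟹ `HeegnerNonTorsionAtTwo` -/

/-- **Heegner points of `E_n` are non-torsion at a rank-one `Ш[2^∞]`-finite datum, on the pinned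
Kato–zeta road** (`HeegnerNonTorsionAtTwo`, p419056's cut of crux B). Displayed hypotheses (module
docstring): Kato's finiteness theorem `hKato` (refereed fact); (R+K) `hRK` [Kato Thm. 12.4, §14.14 +
Poitou–Tate over `ℚ_∞`; Burungale–Tian 2026 Thm. 2.6 = [ABS] Thm. 10.6 — PRINT]; (3.1′) `h31`
[[ABS] §10.1.3, control for the strict Selmer group — PRINT]; (3.1″) `h31b` [[ABS] §10.1.3 «`0 ≠ loc_p(z_E)`»
+ injectivity of `log` on `E(ℚ_p) ⊗ ℚ_p` — PRINT]; (PR₂) `hPR : PRFormulaAtTwoH2` [OPEN]. Proof = [ABS]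
§10.1.3 verbatim: rank `1` ⟹ `L(E_n,1) = 0` (Kato); take the pinned datum with (K); (K) + (3.1′) ⟹
`ι[z]` not `ℤ₂`-torsion (the S3 road's PROVED `Λ`-module step `KatoZeta.forall_pow_smul_iota_zeta_ne_zero`,
Burungale–Tian Thm. 3.1); (PR₂) at an embedding `ι : K → ℚ₂` over a degree-one prime (`X11b.embAt`) gives
`HasLocPKummerLog … (c·log_ω(P)²)` with `c ≠ 0`; (3.1″) makes `c·log_ω(P)² ≠ 0`; but a torsion `P` has
`log_ω(P) = 0` (`padicLogPoint_formalIndex_smul_eq_zero_of_isOfFinAddOrder`). CONDITIONAL on the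
displayed hypotheses; credits nothing.
[cite: AlpogeBhargavaShnidman2022, App. A Thm. 10.1, Thm. 10.6, Thm. 10.8, §10.1.3 (pp. 33–34)]
[cite: BurungaleTian2026, Thm. 2.6 and Thm. 3.1] [cite: Kato2004Asterisque, Thm. 12.4, Conj. 12.10, §14.14, Cor. 14.3] -/
theorem heegnerNonTorsionAtTwo_of_prFormulaH2_of_readings
    (hKato : ∀ (W : WeierstrassCurve ℚ) [W.IsElliptic] (p : ℕ) [Fact p.Prime],
      kato_finite_of_L_one_ne_zero W p)
    (hRK : ∀ ⦃n : ℕ⦄, Squarefree n →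
      ∀ [(congruentNumberCurve n).IsElliptic] [(congruentNumberCurve n).IsGloballyMinimal]
        [ContinuousSMul ℤ_[2] ((congruentNumberCurve n).tateModule 2)],
        ∃ D : KatoDescentDatum 2, Nonempty (KatoDescentDatumPinH2 (congruentNumberCurve n) 2 D) ∧
          ∃ a b : ℕ,
            Ideal.span {((2 : ℕ) : IwasawaAlgebra 2) ^ a} * Module.charIdeal (IwasawaAlgebra 2) D.H2 =
              Ideal.span {((2 : ℕ) : IwasawaAlgebra 2) ^ b} *
                Module.charIdeal (IwasawaAlgebra 2) (D.H ⧸ (IwasawaAlgebra 2) ∙ D.z))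
    (h31 : ∀ ⦃n : ℕ⦄, Squarefree n →
      ∀ [(congruentNumberCurve n).IsElliptic] [(congruentNumberCurve n).IsGloballyMinimal]
        [ContinuousSMul ℤ_[2] ((congruentNumberCurve n).tateModule 2)]
        (D : KatoDescentDatum 2), Nonempty (KatoDescentDatumPinH2 (congruentNumberCurve n) 2 D) →
        (congruentNumberCurve n).mordellWeilRank = 1 →
          Finite (AddCommGroup.primaryComponent (congruentNumberCurve n).sha 2) →
            Finite (IwasawaAlgebra.coinvariants 2 D.H2))
    (h31b : ∀ ⦃n : ℕ⦄, Squarefree n →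
      ∀ [(congruentNumberCurve n).IsElliptic] [(congruentNumberCurve n).IsGloballyMinimal]
        [ContinuousSMul ℤ_[2] ((congruentNumberCurve n).tateModule 2)]
        (D : KatoDescentDatum 2) (pin : KatoDescentDatumPinH2 (congruentNumberCurve n) 2 D),
        (congruentNumberCurve n).mordellWeilRank = 1 →
          Finite (AddCommGroup.primaryComponent (congruentNumberCurve n).sha 2) →
            (∀ m : ℕ, 2 ^ m • D.ι (Submodule.Quotient.mk D.z) ≠ 0) →
              ∀ t : ℚ_[2], HasLocPKummerLog (congruentNumberCurve n) 2 pin.katoClass t → t ≠ 0)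
    (hPR : PRFormulaAtTwoH2) :
    HeegnerNonTorsionAtTwo := by
  intro n hsq K _ _ N _ hN hK hHN hH2 hLK hrank hsha P hP hPtor
  haveI := isElliptic_congruentNumberCurve hsq.ne_zero
  haveI := isGloballyMinimal_congruentNumberCurve hsq
  haveI : ContinuousSMul ℤ_[2] ((congruentNumberCurve n).tateModule 2) :=
    TateModule.continuousSMul_padicInt
  -- an embedding `ι : K → ℚ₂` at a degree-one prime over `2` (`2` splits in `K`)
  obtain ⟨-, -, 𝔭, -, -, h𝔭, he, hf⟩ :=
    Summit.BirchSwinnertonDyer.Rank1Residual.X11b.exists_anticyclotomic_generator_degreeOnePrime 2 K hK hH2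
  set ι : K →+* ℚ_[2] := Summit.BirchSwinnertonDyer.Rank1Residual.X11b.embAt K 2 𝔭 h𝔭 he hf with hιdef
  -- rank one ⟹ `L(E_n, 1) = 0` (Kato's finiteness theorem)
  have hL : (congruentNumberCurve n).entireLFunction 1 = 0 :=
    CongruentShaFreeCutKatoZetaRoad.entireLFunction_one_eq_zero_of_mordellWeilRank_eq_one
      (congruentNumberCurve n) 2 (hKato _ 2) hrank
  -- the pinned datum with Kato's main conjecture; `ι[z]` is not `ℤ₂`-torsion
  obtain ⟨D, ⟨pin⟩, hMC⟩ := hRK hsq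
  have hz : ∀ m : ℕ, 2 ^ m • D.ι (Submodule.Quotient.mk D.z) ≠ 0 :=
    KatoZeta.forall_pow_smul_iota_zeta_ne_zero D hMC (h31 hsq D ⟨pin⟩ hrank hsha)
  -- Perrin-Riou's formula at `ι`, `P`, and the pinned datum
  obtain ⟨c, hc, hPRx⟩ := hPR hsq K N hN hK hHN hH2 hLK ι P hP hL D pin hMC
  have ht : c * padicLogOmega (congruentNumberCurve n) 2 ι P ^ 2 ≠ 0 :=
    h31b hsq D pin hrank hsha hz _ hPRx
  -- but a torsion Heegner point has `log_ω(P) = 0`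
  have hlog : padicLogOmega (congruentNumberCurve n) 2 ι P = 0 := by
    unfold padicLogOmega
    rw [AcPConverseLinks.padicLogPoint_formalIndex_smul_eq_zero_of_isOfFinAddOrder
      (congruentNumberCurve n) 2 ι hPtor, zero_div]
  exact ht (by rw [hlog, zero_pow two_ne_zero, mul_zero])

/-! ## §3 Crux B by name on the pinned Kato–zeta road -/

/-- **Crux B `AnalyticRankOneOfRankOneFiniteShaTwo` (stmt-BirchSwinnertonDyer-19080) on the PINNED
Kato–zeta / Perrin-Riou road.** Displayed hypotheses: the six refereed facts of the line of record
(`2`-parity `hpar`, modularity `hmod`, Hoffstein–Luo `hHL`, Kato `hKato`, existence of Heegner points `hHP`,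
Gross–Zagier + Kolyvagin `hGZ` = [ABS] Thm. 10.8 (b)), the three PRINT readings (R+K) `hRK`, (3.1′) `h31`,
(3.1″) `h31b`, and ONE research statement `hPR : PRFormulaAtTwoH2`. Proof:
`analyticRankOne_of_facts_of_heegnerNonTorsion` (p419056) ∘ `heegnerNonTorsionAtTwo_of_prFormulaH2_of_readings`.
NUMBERS on this road: crux B = 6 refereed facts + 3 print readings on Kato's pinned objects + 1 open
FORMULA (Perrin-Riou at the additive prime `2`); no anticyclotomic construction, no Wan-type divisibility,
no Poitou–Tate over `K`. CONDITIONAL; closes nothing.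
[cite: AlpogeBhargavaShnidman2022, App. A Thm. 10.1, Rem. 10.5 (i), Thm. 10.6, Thm. 10.8, §10.1.3; §2 after Thm. 2.10]
[cite: BurungaleTian2026, Thm. 2.6] [cite: GrossZagier1986, Thm. I.6.3 with V.§2] [cite: Kato2004Asterisque, Cor. 14.3, §14.14] -/
theorem cruxB_of_prFormulaH2_of_readings
    (hpar : ∀ (W : WeierstrassCurve ℚ) [W.IsElliptic] (p : ℕ) [Fact p.Prime], p_parity W p)
    (hmod : ModularForms.exists_isNewformOf) (hHL : HoffsteinLuo1997_exists_twist_L_one_ne_zero)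
    (hKato : ∀ (W : WeierstrassCurve ℚ) [W.IsElliptic] (p : ℕ) [Fact p.Prime],
      kato_finite_of_L_one_ne_zero W p)
    (hHP : ∀ (W : WeierstrassCurve ℚ) (K : Type) [Field K] [NumberField K],
      exists_isHeegnerPoint W K)
    (hGZ : ∀ (W : WeierstrassCurve ℚ) (N : ℕ) [NeZero N] (K : Type) [Field K] [NumberField K],
      analyticRankEK_eq_one_iff_heegner_nonTorsion W N K)
    (hRK : ∀ ⦃n : ℕ⦄, Squarefree n →
      ∀ [(congruentNumberCurve n).IsElliptic] [(congruentNumberCurve n).IsGloballyMinimal]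
        [ContinuousSMul ℤ_[2] ((congruentNumberCurve n).tateModule 2)],
        ∃ D : KatoDescentDatum 2, Nonempty (KatoDescentDatumPinH2 (congruentNumberCurve n) 2 D) ∧
          ∃ a b : ℕ,
            Ideal.span {((2 : ℕ) : IwasawaAlgebra 2) ^ a} * Module.charIdeal (IwasawaAlgebra 2) D.H2 =
              Ideal.span {((2 : ℕ) : IwasawaAlgebra 2) ^ b} *
                Module.charIdeal (IwasawaAlgebra 2) (D.H ⧸ (IwasawaAlgebra 2) ∙ D.z))
    (h31 : ∀ ⦃n : ℕ⦄, Squarefree n →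
      ∀ [(congruentNumberCurve n).IsElliptic] [(congruentNumberCurve n).IsGloballyMinimal]
        [ContinuousSMul ℤ_[2] ((congruentNumberCurve n).tateModule 2)]
        (D : KatoDescentDatum 2), Nonempty (KatoDescentDatumPinH2 (congruentNumberCurve n) 2 D) →
        (congruentNumberCurve n).mordellWeilRank = 1 →
          Finite (AddCommGroup.primaryComponent (congruentNumberCurve n).sha 2) →
            Finite (IwasawaAlgebra.coinvariants 2 D.H2))
    (h31b : ∀ ⦃n : ℕ⦄, Squarefree n →
      ∀ [(congruentNumberCurve n).IsElliptic] [(congruentNumberCurve n).IsGloballyMinimal]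
        [ContinuousSMul ℤ_[2] ((congruentNumberCurve n).tateModule 2)]
        (D : KatoDescentDatum 2) (pin : KatoDescentDatumPinH2 (congruentNumberCurve n) 2 D),
        (congruentNumberCurve n).mordellWeilRank = 1 →
          Finite (AddCommGroup.primaryComponent (congruentNumberCurve n).sha 2) →
            (∀ m : ℕ, 2 ^ m • D.ι (Submodule.Quotient.mk D.z) ≠ 0) →
              ∀ t : ℚ_[2], HasLocPKummerLog (congruentNumberCurve n) 2 pin.katoClass t → t ≠ 0)
    (hPR : PRFormulaAtTwoH2) :
    AnalyticRankOneOfRankOneFiniteShaTwo :=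
  analyticRankOne_of_facts_of_heegnerNonTorsion hpar hmod hHL hKato hHP hGZ
    (heegnerNonTorsionAtTwo_of_prFormulaH2_of_readings hKato hRK h31 h31b hPR)

end Summit.BirchSwinnertonDyer.BirchSwinnertonDyer.Theorems.CongruentShaFreeCutKatoZetaRoadPinnedH2

end
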